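import Summits.HodgeConjecture.FermatCycles.HodgeFermatKRFreeFacts
import Summits.HodgeConjecture.FermatCycles.HodgeFermatTheoremLRowsB
import Summits.HodgeConjecture.FermatCycles.HodgeFermatDecodingC

/-!
# THE BRIDGE between the executable model of `KRFreeFacts` and the `Prop` model of `LemmaN` (`HodgeFermat/Bridge.lean`; HF-G21f)

Tree copy (whole module) of the module `HodgeFermat/Bridge.lean` of the sibling cell's standalone package
`run/shared/lean/pub/pub-hodgefermat/lean/HodgeFermat/` (223 lines, sha256 `74d2ea351d05f263…`), source lines 25–223 (all: `inType` decides `InH`, masks from types `cmMask_eq_of_sameType`, sorted reduced triples, `coincidenceFree_first`).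
Filed by cell `pub-hfermat`, seat prover-1 gen-3, on the COORDINATOR KEEPER RULING of 2026-08-25 (gem sweep H1: take the
off-gate kernel theorem `thmFstar` through the gate) — here THEOREM F* of `tables/DPRIME-THEOREM.md` §9 IN FULL, i.e.
PROPOSITION D′(3N) and the descent (`HodgeFermat/PropDPrimeNFinal.lean`, GATE HF-G34), the last off-gate form of THEOREM F*
(its first two forms, `DecodingFinal.thmFstar` = F* at the prime levels and `ThmFstarNFinal.thmFstar` = F*(3N), landed on
2026-08-25 as `HodgeFermatThmFstar.lean` / `HodgeFermatThmFstarN.lean`, seats prover-1 gen-0 / gen-2); this file is one link of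
the import closure of `PropDPrimeNFinal.propDprime` (the sibling's KR-free chain: THEOREM L, COROLLARY M, THEOREM D6,
THEOREM U⁺, THEOREM KR6, THEOREM Z3U) on top of those landed chains.  The source module is the sibling's hub-checked module of
record (pub-hodgefermat `CERT.md` l.879, GATE HF-G21f); its declarations are copied VERBATIM.
Deviations from the source module, exhaustively: the `import` lines (tree modules `Summits.HodgeConjecture.FermatCycles.
HodgeFermat*` instead of `HodgeFermat.*`); this module docstring; DEDUP (pre-empting the gate's `dedup.landed`): seven generic lemmas of the source restate VERBATIM (up to names) lemmas of the landed `HodgeFermatDecodingC.lean` (`HodgeFermat.KRFree.Decoding.unit_mul_not_dvd`, `rsum_swap`, `rsum_rot`, `st_symm`, `st_trans`, `st_swap`, `st_rot`): `not_dvd_unit_mul` (l.63–65), `rsum_swap` (l.71–73), `rsum_rot` (l.74–76), `sameType_symm` (l.77–79), `sameType_trans` (l.80–82), `sameType_swap` (l.83–89), `sameType_rot` (l.90–96) — all DELETED and re-bound under their source names by the two added lines `open HodgeFermat.KRFree.Decoding renaming st_symm → sameType_symm, st_trans → sameType_trans, st_swap → sameType_swap, st_rot → sameType_rot, unit_mul_not_dvd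 → not_dvd_unit_mul` / `open HodgeFermat.KRFree.Decoding (rsum_swap rsum_rot)` (extra import) so that every use site stays byte-identical (the same two lines are added to the downstream files that opened `Bridge` for these names); one-line docstrings added (gate lint) to `inType_iff`, `mem_units`, `foldl_congr_mem`, `third_eq`, `mem_triples`, `res_pos`, `dvd_sum_mod`.
Every other line — in particular every declaration's statement and proof — is byte-identical to the source.
HONEST FRAMING: explicit algebraic cycles for specific Hodge classes on Fermat/Delsarte varieties; residual open instances
listed; no claim on general Hodge.  (This file is arithmetic of CM types / finite combinatorics / analytic number theory
of the sibling's KR-free programme; it claims nothing about cycles.)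

The source module's docstring (Bridge.lean l.1–21), verbatim:

HodgeFermat/Bridge.lean — generation 21 (fourth addendum) of the hodge-fermat build.

THE BRIDGE between the two models of the CM type in this package:
* `KRFreeFacts.lean` (gen 19): executable, `Bool`-valued — `units N`, `triples N` (sorted reduced triples),
  `inType N T t`, the bitmask `cmMask N T`, and `CoincidenceFree N` (equal masks ⇒ equal sorted triples),
  with the kernel-checked facts `F5`, `F35`, `F55`, `F65`, `F85`, `F95`;
* `LemmaN.lean` / `TheoremLRows.lean` (gen 21): `Prop`-valued — `InH N T t`, `SameType N T T'` (equal CM types on the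
  units), `rsum`.

Proved here, for every level `N`:
* `cmMask_eq_of_sameType` : `SameType N T T' → cmMask N T = cmMask N T'`;
* `sameType_swap`, `sameType_rot`, `sameType_mod` : the CM type of a triple with no zero entry is invariant under
  permuting and reducing its entries (on units, `t ∈ H_T ⟺` residue sum `= N`);
* `coincidenceFree_first` : if `CoincidenceFree N`, two triples with no zero entry mod `N` and the same CM type
  have the same multiset of residues — stated in the form used downstream: the first entry of the one is
  congruent mod `N` to some entry of the other.
So the finite facts of `KRFreeFacts.lean` become usable on the `SameType` side (first use: `PropL7a.lean`, F35).

No `sorry`; no `native_decide`; `autoImplicit false`.  Lean 4 v4.32.0 / Mathlib v4.32.0.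
-/

set_option autoImplicit false

namespace HodgeFermat.KRFree.Bridge

open HodgeFermat.KRFree HodgeFermat.KRFree.LemmaN HodgeFermat.KRFree.TheoremL

open HodgeFermat.KRFree.Decoding renaming st_symm → sameType_symm, st_trans → sameType_trans, st_swap → sameType_swap, st_rot → sameType_rot, unit_mul_not_dvd → not_dvd_unit_mul
open HodgeFermat.KRFree.Decoding (rsum_swap rsum_rot)

/-! ## `inType` decides `InH`; masks from types -/

/-- the Boolean `inType` decides `InH` -/
lemma inType_iff (N : ℕ) (T : ℕ × ℕ × ℕ) (t : ℕ) : inType N T t = true ↔ InH N T t := by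
  simp [inType, InH]

/-- members of `units N` are prime to `N` -/
lemma mem_units {N t : ℕ} (h : t ∈ units N) : Nat.Coprime t N := by
  unfold units at h
  simp only [List.mem_filter, List.mem_range, decide_eq_true_eq] at h
  exact h.2.2

/-- `foldl` congruence for functions agreeing on the list -/
lemma foldl_congr_mem {α β : Type} (f g : β → α → β) (l : List α)
    (H : ∀ b, ∀ a ∈ l, f b a = g b a) (b : β) : l.foldl f b = l.foldl g b := by
  induction l generalizing b with
  | nil => rfl
  | cons a l ih =>
    simp only [List.foldl_cons]
    rw [H b a List.mem_cons_self]
    exact ih (fun b' a' ha' => H b' a' (List.mem_cons_of_mem a ha')) _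

/-- equal CM types (on the units) give equal masks -/
theorem cmMask_eq_of_sameType {N : ℕ} {T T' : ℕ × ℕ × ℕ} (h : SameType N T T') :
    cmMask N T = cmMask N T' := by
  unfold cmMask
  congr 1
  apply foldl_congr_mem
  intro acc t ht
  have hi : inType N T t = inType N T' t := by
    rw [Bool.eq_iff_iff, inType_iff, inType_iff]
    exact h t (mem_units ht)
  rw [hi]

/-! ## Permuting and reducing the entries -/
/-- for a unit `t` and a triple whose third entry is non-zero mod `N`: `t ∈ H_T` iff the residue sum is `N` -/
lemma inH_iff_rsum {N x y z t : ℕ} (hN : 0 < N) (hs : N ∣ x + y + z) (ht : Nat.Coprime t N)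
    (hz : ¬ N ∣ z) : InH N (x, y, z) t ↔ rsum N (x, y, z) t = N :=
  (rsum_cases hN hs (not_dvd_unit_mul ht hz)).2
/-- reducing the entries mod `N` -/
lemma sameType_mod (N x y z : ℕ) : SameType N (x, y, z) (x % N, y % N, z % N) := by
  intro t _
  unfold InH
  dsimp only
  rw [Nat.mul_mod_mod, Nat.mul_mod_mod]

/-! ## Sorted reduced triples are `triples N` -/

/-- the third entry of a reduced zero-sum triple is `(2N − a − b) mod N` -/
lemma third_eq {N a b c : ℕ} (ha : 0 < a) (haN : a < N) (hb : 0 < b) (hbN : b < N) (hc : 0 < c) (hcN : c < N)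
    (hs : N ∣ a + b + c) : c = (2 * N - a - b) % N := by
  obtain ⟨k, hk⟩ := hs
  have hk1 : 1 ≤ k := by
    by_contra h0
    have : k = 0 := by omega
    subst this; omega
  have hk2 : k ≤ 2 := by
    by_contra h3
    have : N * 3 ≤ N * k := Nat.mul_le_mul_left N (by omega)
    omega
  interval_cases k
  · have e : 2 * N - a - b = c + N := by omega
    rw [e, Nat.add_mod_right, Nat.mod_eq_of_lt hcN]
  · have e : 2 * N - a - b = c := by omega
    rw [e, Nat.mod_eq_of_lt hcN]

/-- a sorted reduced zero-sum triple belongs to `triples N` -/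
lemma mem_triples {N a b c : ℕ} (ha : 0 < a) (haN : a < N) (hb : 0 < b) (hbN : b < N) (hc : 0 < c)
    (hcN : c < N) (hs : N ∣ a + b + c) (hab : a ≤ b) (hbc : b ≤ c) : (a, b, c) ∈ triples N := by
  have h3 := third_eq ha haN hb hbN hc hcN hs
  unfold triples
  simp only [List.mem_flatMap, List.mem_range]
  refine ⟨a, haN, b, hbN, ?_⟩
  show (a, b, c) ∈ (if a ≠ 0 ∧ b ≠ 0 ∧ (2 * N - a - b) % N ≠ 0 ∧ a ≤ b ∧ b ≤ (2 * N - a - b) % N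
    then [(a, b, (2 * N - a - b) % N)] else [])
  rw [← h3, if_pos ⟨ha.ne', hb.ne', hc.ne', hab, hbc⟩]
  exact List.mem_singleton.mpr rfl

/-- a residue triple with no zero entry, sorted: a member of `triples N` of the same CM type, carrying the same
entries -/
lemma exists_sorted {N a b c : ℕ} (hN : 0 < N) (ha : 0 < a) (haN : a < N) (hb : 0 < b) (hbN : b < N)
    (hc : 0 < c) (hcN : c < N) (hs : N ∣ a + b + c) :
    ∃ T ∈ triples N, SameType N (a, b, c) T ∧ (a = T.1 ∨ a = T.2.1 ∨ a = T.2.2) ∧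
      (T.1 = a ∨ T.1 = b ∨ T.1 = c) ∧ (T.2.1 = a ∨ T.2.1 = b ∨ T.2.1 = c) ∧
      (T.2.2 = a ∨ T.2.2 = b ∨ T.2.2 = c) := by
  have na : ¬ N ∣ a := fun h => by have := Nat.le_of_dvd ha h; omega
  have nb : ¬ N ∣ b := fun h => by have := Nat.le_of_dvd hb h; omega
  have nc : ¬ N ∣ c := fun h => by have := Nat.le_of_dvd hc h; omega
  have hs_bac : N ∣ b + a + c := by rwa [show b + a + c = a + b + c by ring]
  have hs_cab : N ∣ c + a + b := by rwa [show c + a + b = a + b + c by ring]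
  have hs_acb : N ∣ a + c + b := by rwa [show a + c + b = a + b + c by ring]
  have hs_bca : N ∣ b + c + a := by rwa [show b + c + a = a + b + c by ring]
  have hs_cba : N ∣ c + b + a := by rwa [show c + b + a = a + b + c by ring]
  -- the six permutations, each reachable by swaps and rotations
  have p_abc : SameType N (a, b, c) (a, b, c) := fun t _ => Iff.rfl
  have p_bac : SameType N (a, b, c) (b, a, c) := sameType_swap hN hs nc
  have p_cab : SameType N (a, b, c) (c, a, b) := sameType_rot hN hs nb nc
  have p_acb : SameType N (a, b, c) (a, c, b) := sameType_trans p_cab (sameType_swap hN hs_cab nb)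
  have p_bca : SameType N (a, b, c) (b, c, a) := sameType_trans p_cab (sameType_rot hN hs_cab na nb)
  have p_cba : SameType N (a, b, c) (c, b, a) := sameType_trans p_bca (sameType_swap hN hs_bca na)
  rcases le_total a b with hab | hba
  · rcases le_total b c with hbc | hcb
    · exact ⟨(a, b, c), mem_triples ha haN hb hbN hc hcN hs hab hbc, p_abc, by simp, by simp, by simp, by simp⟩
    · rcases le_total a c with hac | hca
      · exact ⟨(a, c, b), mem_triples ha haN hc hcN hb hbN hs_acb hac hcb, p_acb, by simp, by simp, by simp, by simp⟩
      · exact ⟨(c, a, b), mem_triples hc hcN ha haN hb hbN hs_cab hca hab, p_cab, by simp, by simp, by simp, by simp⟩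
  · rcases le_total a c with hac | hca
    · exact ⟨(b, a, c), mem_triples hb hbN ha haN hc hcN hs_bac hba hac, p_bac, by simp, by simp, by simp, by simp⟩
    · rcases le_total b c with hbc | hcb
      · exact ⟨(b, c, a), mem_triples hb hbN hc hcN ha haN hs_bca hbc hca, p_bca, by simp, by simp, by simp, by simp⟩
      · exact ⟨(c, b, a), mem_triples hc hcN hb hbN ha haN hs_cba hcb hba, p_cba, by simp, by simp, by simp, by simp⟩

/-! ## The finite facts on the `SameType` side -/

/-- the residue of a non-multiple of `N` is positive -/
lemma res_pos {N x : ℕ} (hx : ¬ N ∣ x) : 0 < x % N := by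
  rw [Nat.pos_iff_ne_zero]; intro h; exact hx (Nat.dvd_of_mod_eq_zero h)

/-- `N` divides the sum of the residues of a zero-sum triple -/
lemma dvd_sum_mod {N x y z : ℕ} (hs : N ∣ x + y + z) : N ∣ x % N + y % N + z % N := by
  rw [Nat.dvd_iff_mod_eq_zero] at hs ⊢
  rw [Nat.add_mod (x % N + y % N) (z % N) N, Nat.mod_mod, ← Nat.add_mod x y N, ← Nat.add_mod (x + y) z N, hs]

/-- With `CoincidenceFree N`: two triples with no zero entry mod `N` and the same CM type have the same
residues — the first entry of the one is congruent to an entry of the other. -/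
theorem coincidenceFree_first {N : ℕ} (hF : CoincidenceFree N) (hN : 0 < N) (x₁ x₂ x₃ y₁ y₂ y₃ : ℕ)
    (hs : N ∣ x₁ + x₂ + x₃) (hs' : N ∣ y₁ + y₂ + y₃)
    (h₁ : ¬ N ∣ x₁) (h₂ : ¬ N ∣ x₂) (h₃ : ¬ N ∣ x₃) (h₁' : ¬ N ∣ y₁) (h₂' : ¬ N ∣ y₂) (h₃' : ¬ N ∣ y₃)
    (h : SameType N (x₁, x₂, x₃) (y₁, y₂, y₃)) :
    x₁ % N = y₁ % N ∨ x₁ % N = y₂ % N ∨ x₁ % N = y₃ % N := by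
  obtain ⟨T, hT, hXT, haT, -, -, -⟩ := exists_sorted hN (res_pos h₁) (Nat.mod_lt _ hN) (res_pos h₂)
    (Nat.mod_lt _ hN) (res_pos h₃) (Nat.mod_lt _ hN) (dvd_sum_mod hs)
  obtain ⟨T', hT', hYT', -, h1', h2', h3'⟩ := exists_sorted hN (res_pos h₁') (Nat.mod_lt _ hN) (res_pos h₂')
    (Nat.mod_lt _ hN) (res_pos h₃') (Nat.mod_lt _ hN) (dvd_sum_mod hs')
  have hTT' : SameType N T T' :=
    sameType_trans (sameType_symm hXT) (sameType_trans (sameType_symm (sameType_mod N x₁ x₂ x₃))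
      (sameType_trans h (sameType_trans (sameType_mod N y₁ y₂ y₃) hYT')))
  have hE := hF T hT T' hT' (cmMask_eq_of_sameType hTT')
  subst hE
  rcases haT with e | e | e
  · rw [e]; rcases h1' with f | f | f
    · exact Or.inl f
    · exact Or.inr (Or.inl f)
    · exact Or.inr (Or.inr f)
  · rw [e]; rcases h2' with f | f | f
    · exact Or.inl f
    · exact Or.inr (Or.inl f)
    · exact Or.inr (Or.inr f)
  · rw [e]; rcases h3' with f | f | f
    · exact Or.inl f
    · exact Or.inr (Or.inl f)
    · exact Or.inr (Or.inr f)

/-! ## Kernel instances -/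

/-- the bridge in action at level 5 (`F5`): the triples `(1, 1, 3)` and `(6, 8, 1)` have the same CM type,
so `1 ≡` some entry of `(6, 8, 1)` (mod 5) — indeed they are the same triple mod 5 up to order -/
example : (1 : ℕ) % 5 = 6 % 5 ∨ (1 : ℕ) % 5 = 8 % 5 ∨ (1 : ℕ) % 5 = 1 % 5 :=
  coincidenceFree_first F5 (by norm_num) 1 1 3 6 8 1 (by norm_num) (by norm_num) (by decide) (by decide)
    (by decide) (by decide) (by decide) (by decide)
    (sameType_of_fin (by norm_num) (by decide))

/-- masks from types: at `N = 15` the class-mates `(5, 5, 5)` … (control: level 15 is NOT coincidence-free,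
`control_level15` of `KRFreeFacts.lean`; the bridge itself holds at every level) -/
example : cmMask 15 (1, 4, 10) = cmMask 15 (1, 10, 4) :=
  cmMask_eq_of_sameType (sameType_trans (sameType_rot (by norm_num) (by norm_num) (by decide) (by decide))
    (sameType_swap (by norm_num) (by norm_num) (by decide)))

end HodgeFermat.KRFree.Bridge
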